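import Literature.NumberTheory.LFunctions.PerronTruncated
import Literature.NumberTheory.LFunctions.DedekindZetaUniformBounds
import HarnessLib

/-!
# The truncated Perron formula for `ψ_K(x)` at half-integers, uniformly in the number field

Topic `Literature/NumberTheory/LFunctions` (namespace `Literature.NumberTheory.LFunctions.NumberField`,
next to `PerronTruncated.lean`, whose proof for `a_n = Λ(n)` is followed line by line).
Everything in this file is PROVED; there are no named facts.

For a number field `K` of degree `n_K = [K : ℚ]` let `Λ_K` be its von Mangoldt weight
(`vonMangoldtIdeal K`, `−ζ_K'/ζ_K(s) = ∑ Λ_K(n) n^{-s}` on `σ > 1`, `DedekindZetaVonMangoldt.lean`)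
and `ψ_K(x) = ∑_{n ≤ x} Λ_K(n)` (`chebyshevPsiIdeal K`). Montgomery–Vaughan, *Multiplicative
Number Theory I*, Thm. 5.2 / Cor. 5.3 (truncated Perron formula) with `a_n = Λ_K(n)`,
`σ₀ = c = 1 + 1/log x`, `x = N + 1/2` a half-integer and truncation heights `T₁, T₂ ≥ T > 0` give

  `∫_{-T₂}^{T₁} (∑_n Λ_K(n) n^{-(c+it)}) x^{c+it}/(c+it) dt = 2π ψ_K(x) + O(n_K · x log² x / T)`

with an ABSOLUTE implied constant (`exists_norm_perron_vonMangoldtIdeal_sub_le`): the remainder of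
Cor. 5.3 is `≪ ∑_n Λ_K(n) (x/n)^c (1/T₁ + 1/T₂)/|log(x/n)|`, and `Λ_K(n) ≤ n_K Λ(n)`
(`vonMangoldtIdeal_le_finrank_mul_vonMangoldt`, Lagarias–Odlyzko 1977 §5 / Landau 1903 §11)
reduces it to the tree's estimate `∑ Λ(n)(x/n)^c/|log(x/n)| ≪ x log² x`
(`Literature.NumberTheory.LFunctions.exists_perronSum_le`). This is the first step (the right edge of
the contour) of the Lagarias–Odlyzko truncated explicit formula for `ψ_K` (Lagarias–Odlyzko 1977,
§§6–7; Winckler 2013, §3, `R₁(x,T)`), uniformly in `K`.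

* `hasSum_vonMangoldtIdeal_mul_cpow_div` — `∑ Λ_K(n)(x/n)^s/s = L(Λ_K, s) x^s/s` (`σ > 1`);
* `exists_tsum_vonMangoldtIdeal_div_rpow_le` — `∑ Λ_K(n)/n^σ ≤ n_K (1/(σ−1) + K₀)`, `1 < σ ≤ 2`;
* `exists_perronSum_vonMangoldtIdeal_le` — `∑ Λ_K(n)(x/n)^c/|log(x/n)| ≤ A n_K x log² x`;
* `exists_norm_perron_vonMangoldtIdeal_sub_le` — the truncated Perron formula above.

## References

* H. L. Montgomery, R. C. Vaughan, *Multiplicative Number Theory I. Classical Theory*, CUP 2007,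
  §5.1 Thm. 5.2, Cor. 5.3. [cite: MontgomeryVaughan2007, Cor. 5.3]
* J. C. Lagarias, A. M. Odlyzko, *Effective versions of the Chebotarev density theorem*, in:
  Algebraic Number Fields (Durham 1975), Academic Press 1977, 409–464, §§5–7. [cite: LagariasOdlyzko1977, §6]
* B. Winckler, *Théorème de Chebotarev effectif*, arXiv:1311.5715 (2013), §3. [cite: Winckler2013, §3]
-/

noncomputable section

open Complex Set MeasureTheory Filter Topology intervalIntegral Real
open ArithmeticFunction hiding log id
open scoped Chebyshev

namespace Literature.NumberTheory.LFunctions.NumberField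

/-! ### The Dirichlet series of `Λ_K` against the Perron kernel -/

/-- For `x > 0` and `Re s > 1`: `∑_n Λ_K(n) (x/n)^s/s = L(Λ_K, s) · x^s/s`. [folklore] -/
theorem hasSum_vonMangoldtIdeal_mul_cpow_div (K : Type*) [Field K] [NumberField K]
    {x : ℝ} (hx : 0 < x) {s : ℂ} (hs : 1 < s.re) :
    HasSum (fun n : ℕ ↦ (vonMangoldtIdeal K n : ℂ) * ((((x / n : ℝ)) : ℂ) ^ s / s))
      (LSeries (fun n ↦ (vonMangoldtIdeal K n : ℂ)) s * ((x : ℂ) ^ s / s)) := by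
  have h1 : HasSum (LSeries.term (fun n ↦ (vonMangoldtIdeal K n : ℂ)) s)
      (LSeries (fun n ↦ (vonMangoldtIdeal K n : ℂ)) s) :=
    (LSeriesSummable_vonMangoldtIdeal K hs).hasSum
  have h2 := h1.mul_right ((x : ℂ) ^ s / s)
  have hfun : (fun n : ℕ ↦ (vonMangoldtIdeal K n : ℂ) * ((((x / n : ℝ)) : ℂ) ^ s / s)) =
      fun n ↦ LSeries.term (fun n ↦ (vonMangoldtIdeal K n : ℂ)) s n * ((x : ℂ) ^ s / s) := by
    funext n
    rcases Nat.eq_zero_or_pos n with rfl | hn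
    · simp [vonMangoldtIdeal_zero]
    · rw [LSeries.term_of_ne_zero hn.ne', ofReal_div_cpow hx.le (by exact_mod_cast hn) s]
      push_cast
      ring
  rw [hfun]
  exact h2

/-! ### `∑ Λ_K(n)/n^σ ≤ n_K (1/(σ − 1) + O(1))` for `1 < σ ≤ 2` -/

/-- **`∑ Λ_K(n)/n^σ ≤ [K:ℚ] (1/(σ−1) + K₀)` on `1 < σ ≤ 2`**, with the absolute `K₀` of
`Literature.NumberTheory.LFunctions.exists_tsum_vonMangoldt_div_rpow_le` (`∑ Λ(n)/n^σ ≤ 1/(σ−1) + K₀`),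
by `Λ_K(n) ≤ [K:ℚ] Λ(n)` termwise (Lagarias–Odlyzko 1977, §5; Landau 1903, §11).
[cite: LagariasOdlyzko1977, §5] -/
theorem exists_tsum_vonMangoldtIdeal_div_rpow_le :
    ∃ K₀ : ℝ, 0 ≤ K₀ ∧ ∀ (K : Type*) [Field K] [NumberField K], ∀ σ : ℝ, 1 < σ → σ ≤ 2 →
      Summable (fun n : ℕ ↦ vonMangoldtIdeal K n / (n : ℝ) ^ σ) ∧
        ∑' n : ℕ, vonMangoldtIdeal K n / (n : ℝ) ^ σ ≤
          Module.finrank ℚ K * (1 / (σ - 1) + K₀) := by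
  obtain ⟨K₀, hK₀0, hK₀⟩ := exists_tsum_vonMangoldt_div_rpow_le
  refine ⟨K₀, hK₀0, fun K _ _ σ hσ1 hσ2 ↦ ?_⟩
  obtain ⟨hsum, htsum⟩ := hK₀ σ hσ1 hσ2
  have hle : ∀ n : ℕ, vonMangoldtIdeal K n / (n : ℝ) ^ σ ≤
      Module.finrank ℚ K * (Λ n / (n : ℝ) ^ σ) := by
    intro n
    rw [← mul_div_assoc]
    exact div_le_div_of_nonneg_right (vonMangoldtIdeal_le_finrank_mul_vonMangoldt K n)
      (Real.rpow_nonneg (Nat.cast_nonneg n) _)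
  have hnn : ∀ n : ℕ, 0 ≤ vonMangoldtIdeal K n / (n : ℝ) ^ σ := fun n ↦
    div_nonneg (vonMangoldtIdeal_nonneg K n) (Real.rpow_nonneg (Nat.cast_nonneg n) _)
  have hsum' : Summable fun n : ℕ ↦ Module.finrank ℚ K * (Λ n / (n : ℝ) ^ σ) := hsum.mul_left _
  have hsumK : Summable fun n : ℕ ↦ vonMangoldtIdeal K n / (n : ℝ) ^ σ :=
    Summable.of_nonneg_of_le hnn hle hsum'
  refine ⟨hsumK, ?_⟩
  calc ∑' n : ℕ, vonMangoldtIdeal K n / (n : ℝ) ^ σ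
      ≤ ∑' n : ℕ, Module.finrank ℚ K * (Λ n / (n : ℝ) ^ σ) := hsumK.tsum_le_tsum hle hsum'
    _ = Module.finrank ℚ K * ∑' n : ℕ, Λ n / (n : ℝ) ^ σ := tsum_mul_left
    _ ≤ Module.finrank ℚ K * (1 / (σ - 1) + K₀) :=
        mul_le_mul_of_nonneg_left htsum (Nat.cast_nonneg _)

/-! ### The Perron error sum at a half-integer -/

/-- **The Perron error sum for `Λ_K` at a half-integer.** With the absolute `A` of
`Literature.NumberTheory.LFunctions.exists_perronSum_le`: for `N ≥ 3`, `x = N + 1/2`, `c = 1 + 1/log x` and every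
finite set `s` of positive integers, `∑_{n ∈ s} Λ_K(n) (x/n)^c/|log(x/n)| ≤ A [K:ℚ] x log² x`
(termwise `Λ_K ≤ [K:ℚ] Λ`). [cite: MontgomeryVaughan2007, Cor. 5.3] -/
theorem exists_perronSum_vonMangoldtIdeal_le :
    ∃ A : ℝ, 0 < A ∧ ∀ (K : Type*) [Field K] [NumberField K], ∀ N : ℕ, 3 ≤ N → ∀ x c : ℝ,
      x = N + 1 / 2 → c = 1 + 1 / Real.log x → ∀ s : Finset ℕ,
        ∑ n ∈ s, vonMangoldtIdeal K n * (x / n) ^ c / |Real.log (x / n)| ≤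
          A * Module.finrank ℚ K * x * Real.log x ^ 2 := by
  obtain ⟨A, hA0, hA⟩ := exists_perronSum_le
  refine ⟨A, hA0, fun K _ _ N hN x c hx hc s ↦ ?_⟩
  have hx0 : 0 < x := by rw [hx]; positivity
  have hle : ∀ n : ℕ, vonMangoldtIdeal K n * (x / n) ^ c / |Real.log (x / n)| ≤
      Module.finrank ℚ K * (Λ n * (x / n) ^ c / |Real.log (x / n)|) := by
    intro n
    rw [← mul_div_assoc, ← mul_assoc]
    refine div_le_div_of_nonneg_right ?_ (abs_nonneg _)
    exact mul_le_mul_of_nonneg_right (vonMangoldtIdeal_le_finrank_mul_vonMangoldt K n)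
      (Real.rpow_nonneg (by positivity) _)
  calc ∑ n ∈ s, vonMangoldtIdeal K n * (x / n) ^ c / |Real.log (x / n)|
      ≤ ∑ n ∈ s, Module.finrank ℚ K * (Λ n * (x / n) ^ c / |Real.log (x / n)|) :=
        Finset.sum_le_sum fun n _ ↦ hle n
    _ = Module.finrank ℚ K * ∑ n ∈ s, Λ n * (x / n) ^ c / |Real.log (x / n)| := by
        rw [Finset.mul_sum]
    _ ≤ Module.finrank ℚ K * (A * x * Real.log x ^ 2) :=
        mul_le_mul_of_nonneg_left (hA N hN x c hx hc s) (Nat.cast_nonneg _)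
    _ = A * Module.finrank ℚ K * x * Real.log x ^ 2 := by ring

/-! ### The right edge of the contour: termwise integration and Perron's kernel -/

section rightEdge

variable (K : Type*) [Field K] [NumberField K] {N : ℕ} {x c : ℝ}

/-- Continuity in `t` of the `n`-th term `Λ_K(n)(x/n)^{c+it}/(c+it)`. [folklore] -/
lemma continuous_perronTermIdeal (hx : 0 < x) (hc : 0 < c) (n : ℕ) :
    Continuous fun t : ℝ ↦
      (vonMangoldtIdeal K n : ℂ) * ((((x / n : ℝ)) : ℂ) ^ ((c : ℂ) + t * I) / ((c : ℂ) + t * I)) := by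
  rcases Nat.eq_zero_or_pos n with rfl | hn
  · simp only [vonMangoldtIdeal_zero, ofReal_zero, zero_mul]
    exact continuous_const
  · have hn' : (0 : ℝ) < n := by exact_mod_cast hn
    exact continuous_const.mul (continuous_cpow_div_vertical (div_pos hx hn') hc.ne')

/-- The `n`-th term is bounded by `Λ_K(n)(x/n)^c/c` on the line `Re s = c > 0`. [folklore] -/
lemma norm_perronTermIdeal_le (hx : 0 < x) (hc : 0 < c) (n : ℕ) (t : ℝ) :
    ‖(vonMangoldtIdeal K n : ℂ) * ((((x / n : ℝ)) : ℂ) ^ ((c : ℂ) + t * I) / ((c : ℂ) + t * I))‖ ≤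
      vonMangoldtIdeal K n * (x / n) ^ c / c := by
  rcases Nat.eq_zero_or_pos n with rfl | hn
  · simp [vonMangoldtIdeal_zero]
  · rw [norm_mul, Complex.norm_real, Real.norm_eq_abs, abs_of_nonneg (vonMangoldtIdeal_nonneg K n),
      mul_div_assoc]
    refine mul_le_mul_of_nonneg_left ?_ (vonMangoldtIdeal_nonneg K n)
    have hn' : (0 : ℝ) < n := by exact_mod_cast hn
    have := norm_cpow_div_le_vertical (div_pos hx hn') hc.ne' t
    rwa [abs_of_pos hc] at this

/-- **The truncated Perron formula for `ψ_K` at half-integers, uniformly in `K`**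
(Montgomery–Vaughan Thm. 5.2 / Cor. 5.3 with `a_n = Λ_K(n)`, `σ₀ = 1 + 1/log x`;
Lagarias–Odlyzko 1977 §6, the remainder `R₁(x, T)`). There is an absolute `A` such that for every
number field `K`, `N ≥ 3`, `x = N + 1/2`, `c = 1 + 1/log x` and `0 < T ≤ T₁, T₂`,
`‖∫_{-T₂}^{T₁} L(Λ_K, c+it) x^{c+it}/(c+it) dt − 2π ψ_K(x)‖ ≤ A [K:ℚ] x log² x / T`, i.e.
`ψ_K(x) = (1/2πi) ∫_{c−iT₂}^{c+iT₁} (−ζ_K'/ζ_K)(s) x^s ds/s + O([K:ℚ] x log² x / T)`.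
[cite: MontgomeryVaughan2007, Cor. 5.3] -/
theorem exists_norm_perron_vonMangoldtIdeal_sub_le :
    ∃ A : ℝ, 0 < A ∧ ∀ (K : Type*) [Field K] [NumberField K], ∀ N : ℕ, 3 ≤ N → ∀ x c : ℝ,
      x = N + 1 / 2 → c = 1 + 1 / Real.log x → ∀ T T₁ T₂ : ℝ, 0 < T → T ≤ T₁ → T ≤ T₂ →
        ‖(∫ t in (-T₂)..T₁, LSeries (fun n ↦ (vonMangoldtIdeal K n : ℂ)) (c + t * I) *
              ((x : ℂ) ^ ((c : ℂ) + t * I) / ((c : ℂ) + t * I))) -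
            2 * π * chebyshevPsiIdeal K x‖ ≤
          A * Module.finrank ℚ K * x * Real.log x ^ 2 / T := by
  obtain ⟨A, hA0, hA⟩ := exists_perronSum_vonMangoldtIdeal_le
  obtain ⟨K₀, _, hK₀⟩ := exists_tsum_vonMangoldtIdeal_div_rpow_le
  refine ⟨2 * A, by positivity, fun K _ _ N hN x c hx hc T T₁ T₂ hT hT₁ hT₂ ↦ ?_⟩
  classical
  obtain ⟨hx0, hlog, hc1, hc2, hxc, hfloor⟩ := halfInt_facts hN hx hc
  have hc0 : 0 < c := by linarith
  have hT₁0 : 0 < T₁ := hT.trans_le hT₁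
  have hT₂0 : 0 < T₂ := hT.trans_le hT₂
  set F : ℕ → ℝ → ℂ := fun n t ↦
    (vonMangoldtIdeal K n : ℂ) * ((((x / n : ℝ)) : ℂ) ^ ((c : ℂ) + t * I) / ((c : ℂ) + t * I))
    with hF
  set f : ℝ → ℂ := fun t ↦ LSeries (fun n ↦ (vonMangoldtIdeal K n : ℂ)) (c + t * I) *
    ((x : ℂ) ^ ((c : ℂ) + t * I) / ((c : ℂ) + t * I)) with hf
  set w : ℕ → ℝ := fun n ↦ vonMangoldtIdeal K n * (x / n) ^ c / |Real.log (x / n)| with hw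
  have hw0 : ∀ n, 0 ≤ w n := fun n ↦
    div_nonneg (mul_nonneg (vonMangoldtIdeal_nonneg K n) (Real.rpow_nonneg (by positivity) _))
      (abs_nonneg _)
  -- summability of the dominating series `Λ_K(n)(x/n)^c/c = (x^c/c) Λ_K(n)/n^c`
  obtain ⟨hsumc, -⟩ := hK₀ K c hc1 hc2
  have hbsum : Summable fun n : ℕ ↦ vonMangoldtIdeal K n * (x / n) ^ c / c := by
    have := hsumc.mul_left (x ^ c / c)
    refine this.congr fun n ↦ ?_
    rw [Real.div_rpow hx0.le (Nat.cast_nonneg n)]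
    field_simp
  -- (1) termwise integration
  have hDCT : HasSum (fun n ↦ ∫ t in (-T₂)..T₁, F n t) (∫ t in (-T₂)..T₁, f t) := by
    refine intervalIntegral.hasSum_integral_of_dominated_convergence
      (fun n _ ↦ vonMangoldtIdeal K n * (x / n) ^ c / c)
      (fun n ↦ (continuous_perronTermIdeal K hx0 hc0 n).aestronglyMeasurable)
      (fun n ↦ Eventually.of_forall fun t _ ↦ norm_perronTermIdeal_le K hx0 hc0 n t)
      (Eventually.of_forall fun t _ ↦ hbsum) intervalIntegrable_const
      (Eventually.of_forall fun t _ ↦ ?_)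
    have hs : 1 < ((c : ℂ) + t * I).re := by simp; linarith
    exact hasSum_vonMangoldtIdeal_mul_cpow_div K hx0 hs
  -- (2) the integrals of the terms
  have hFint : ∀ n, ∫ t in (-T₂)..T₁, F n t = (vonMangoldtIdeal K n : ℂ) *
      ∫ t in (-T₂)..T₁, ((((x / n : ℝ)) : ℂ) ^ ((c : ℂ) + t * I) / ((c : ℂ) + t * I)) :=
    fun n ↦ intervalIntegral.integral_const_mul _ _
  -- (3) the main part: a finite sum equal to `2π ψ_K(x)`
  set ind : ℕ → ℂ := fun n ↦
    (vonMangoldtIdeal K n : ℂ) * ((if 1 < x / n then 2 * π else 0 : ℝ) : ℂ) with hind_def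
  have hind0 : ∀ n ∉ Finset.range (N + 1), ind n = 0 := by
    intro n hn
    rw [Finset.mem_range, not_lt] at hn
    have hxn : x / n < 1 := by
      have hn' : (N : ℝ) + 1 ≤ n := by exact_mod_cast hn
      rw [div_lt_one (by linarith)]; rw [hx]; linarith
    simp [hind_def, not_lt.2 hxn.le]
  have hind : HasSum ind (2 * π * chebyshevPsiIdeal K x) := by
    have h : HasSum ind (∑ n ∈ Finset.range (N + 1), ind n) := hasSum_sum_of_ne_finset_zero hind0
    have hval : ∑ n ∈ Finset.range (N + 1), ind n = 2 * π * chebyshevPsiIdeal K x := by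
      have h1 : ∀ n ∈ Finset.range (N + 1), ind n = 2 * π * (vonMangoldtIdeal K n : ℂ) := by
        intro n hn
        rw [Finset.mem_range] at hn
        rcases Nat.eq_zero_or_pos n with rfl | hn0
        · simp [hind_def, vonMangoldtIdeal_zero]
        · have hxn : 1 < x / n := by
            have hn' : (0 : ℝ) < n := by exact_mod_cast hn0
            have hn'' : (n : ℝ) ≤ N := by exact_mod_cast Nat.lt_succ_iff.1 hn
            rw [lt_div_iff₀ hn', hx]; linarith
          simp only [hind_def, if_pos hxn]
          push_cast; ring
      rw [Finset.sum_congr rfl h1, ← Finset.mul_sum]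
      congr 1
      have hIcc : Finset.range (N + 1) = Finset.Icc 0 N := by
        ext n; simp only [Finset.mem_range, Finset.mem_Icc, Nat.zero_le, true_and]; omega
      rw [chebyshevPsiIdeal, hfloor, ← hIcc, ofReal_sum]
    rwa [hval] at h
  -- (4) termwise error
  have herr : ∀ n, ‖(∫ t in (-T₂)..T₁, F n t) - ind n‖ ≤ 2 / T * w n := by
    intro n
    rcases Nat.eq_zero_or_pos n with rfl | hn0
    · simp [hFint, hind_def, hw, vonMangoldtIdeal_zero]
    · have hn' : (0 : ℝ) < n := by exact_mod_cast hn0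
      have hy0 : 0 < x / n := div_pos hx0 hn'
      have hP := norm_perronIntegral_sub_le hy0 (halfInt_div_ne_one hx n) hc0 hT₁0 hT₂0
      rw [hFint, hind_def, ← mul_sub, norm_mul, Complex.norm_real, Real.norm_eq_abs,
        abs_of_nonneg (vonMangoldtIdeal_nonneg K n)]
      calc vonMangoldtIdeal K n *
            ‖(∫ t in (-T₂)..T₁, ((((x / n : ℝ)) : ℂ) ^ ((c : ℂ) + t * I) / ((c : ℂ) + t * I))) -
              ((if 1 < x / n then 2 * π else 0 : ℝ) : ℂ)‖
          ≤ vonMangoldtIdeal K n * ((x / n) ^ c * (1 / T₁ + 1 / T₂) / |Real.log (x / n)|) :=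
            mul_le_mul_of_nonneg_left hP (vonMangoldtIdeal_nonneg K n)
        _ ≤ vonMangoldtIdeal K n * ((x / n) ^ c * (2 / T) / |Real.log (x / n)|) := by
            refine mul_le_mul_of_nonneg_left ?_ (vonMangoldtIdeal_nonneg K n)
            refine div_le_div_of_nonneg_right ?_ (abs_nonneg _)
            refine mul_le_mul_of_nonneg_left ?_ (Real.rpow_nonneg hy0.le _)
            have h1 : 1 / T₁ ≤ 1 / T := one_div_le_one_div_of_le hT hT₁
            have h2 : 1 / T₂ ≤ 1 / T := one_div_le_one_div_of_le hT hT₂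
            calc 1 / T₁ + 1 / T₂ ≤ 1 / T + 1 / T := add_le_add h1 h2
              _ = 2 / T := by ring
        _ = 2 / T * w n := by rw [hw]; ring
  -- (5) summation
  have hwsum : Summable w := summable_of_sum_le hw0 (hA K N hN x c hx hc)
  have hwtsum : ∑' n, w n ≤ A * Module.finrank ℚ K * x * Real.log x ^ 2 :=
    Real.tsum_le_of_sum_le hw0 (hA K N hN x c hx hc)
  have hg : HasSum (fun n ↦ 2 / T * w n) (2 / T * ∑' n, w n) := (hwsum.hasSum).mul_left _
  have hmain := (hDCT.sub hind).norm_le_of_bounded hg herr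
  refine hmain.trans ?_
  calc 2 / T * ∑' n, w n ≤ 2 / T * (A * Module.finrank ℚ K * x * Real.log x ^ 2) :=
        mul_le_mul_of_nonneg_left hwtsum (by positivity)
    _ = 2 * A * Module.finrank ℚ K * x * Real.log x ^ 2 / T := by
        field_simp

end rightEdge

end Literature.NumberTheory.LFunctions.NumberField

end
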